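import Summits.QuantumFields.YangMills.Theorems.FluctuationComparisonRegPrIntLOrganTangentTriangularChart
import Literature.MathematicalPhysics.QuantumFieldTheory.Balaban1983to89.BlockAveragingHaarAC
import Literature.MathematicalPhysics.QuantumFieldTheory.Balaban1983to89.T3UnitScaleTilt
import Literature.MathematicalPhysics.QuantumFieldTheory.Balaban1983to89.T3UnitLawDensityEML
import Literature.MathematicalPhysics.QuantumFieldTheory.Balaban1983to89.T3OrbitAverage
import HarnessLib

/-!
# Crux `FluctuationComparisonRegPrIntL` (stmt-QuantumFields-20520, rung R3), LINE g25-1 «organ_tangent» — the (C3) MASS binder `hmass` of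
# ✓`OrganTangentTriangularChart.regularPackage_of_oneVariableInverseLaws` ((L5) v2, ✓p782575) FROM A SMALL LIFT + chart regularity
# in the ENVIRONMENT variable («positivity from an interior point»)

LEAD-20520 width seat ym-ust-20520-w3 g22 (cell ym3-torus), `--supports stmt-QuantumFields-20520` (helper).  THEOREMS ONLY, def-free.

(L5) v2 displays the (C3) mass letter: for every window datum `V`,
`0 < ∫⁻ U in {U | (∀ c, V c ∈ T c U) ∧ PlaqSmall (¾θ_{j+1}) (extend β (fun c => θ c U (V c)) U)}, ∏ c, jac c U (V c) ∂dU_{j+1}`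
(`β c` = the central bond of block `c`, `T c U` the target set and `θ c U` the one-variable inverse of bond `c` in the environment `U`,
`jac` its Jacobian).  ★`mass_of_smallLift` proves it from:
* (LIFT) a `¾θ_{j+1}`-small fine field over every window datum: `∀ V ∈ window_j, ∃ U₀, descend F ℰp j U₀ = V ∧ PlaqSmall (¾θ_{j+1}) U₀` — the
  SPREAD LIFT (px12 g19's (B4) `SpreadLiftOfSmallLift.spreadLift_window` ∕ `spreadLift_threeQuarters`, odd `L ≥ 9`, eventually in `j`);
* (SOL) small fine fields are their own chart points: `PlaqSmall (¾θ_{j+1}) U → descend U c ∈ T c U ∧ θ c U (descend U c) = U (β c)` (the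
  inverse recovers the actual window value — uniqueness on the solution ball, (B1′));
* (REG) regularity in the environment: `{(U, v) | v ∈ T c U}` is OPEN and `(U, v) ↦ θ c U v` is continuous on it; `jac c U v > 0` on it and
  `(U, v) ↦ jac c U v` is measurable.
Mechanism [folklore]: by (SOL) the lift `U₀` lies in the good set and `extend β (θ · U₀ (V ·)) U₀ = U₀`, so `U₀` is a point of the
integration set; by (REG) that set is OPEN (`ContinuousOn.isOpen_inter_preimage`, `PlaqSmall` is an open condition); product Haar on
`SU(2)`-fields charges non-empty open sets (`IsOpenPosMeasure` of a finite product of Haar probability measures); the integrand is positive there.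

HONEST FRAMING: a soft lemma over hypothesis letters; (LIFT)(SOL)(REG) are NOT proved here ((LIFT) = (B4), ✓-pending by px12 g19 for odd
`L ≥ 9`; (SOL)(REG) = (B1′) Stage 1∕2 of w5 g21); nothing of Bałaban's analysis is asserted; the chart laws, (A), COAREA∘, VER∘, O1, crux
20520, `YM3TorusSU2` are NOT proved; registry `Lines/semiclassical_s2beta.lean` v11.4 (★★OWNER RULING №36) untouched; rung R3 = SU(2) YM₃
on T³ — NOT d = 4, NOT infinite volume, NOT a mass gap, NOT Clay; the Yang–Mills mass gap is NOT proved by any of this.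
-/

set_option autoImplicit false

noncomputable section

namespace Summit.QuantumFields.YangMills.Theorems.OrganTangentMassOfSmallLift

open MeasureTheory Filter Topology Set Function
open scoped ENNReal NNReal
open Literature.MathematicalPhysics.QuantumFieldTheory.Balaban1983to89
open T4Continuum T3ContinuumYM3Torus T3NestedUnitLaws T3UnitLawDensityEML T3UnitScaleTilt T3LevelShift
open Literature.MathematicalPhysics.QuantumFieldTheory.Balaban1983to89.T3OrbitAverage
open Literature.MathematicalPhysics.QuantumFieldTheory.Balaban1983to89.BlockAveragingHaarAC (centralBond centralBond_injective)
open Summit.QuantumFields.YangMills.Theorems.OrganTangentFibreMeanTools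
open Summit.QuantumFields.YangMills.Theorems (OrganTangentTriangularChart.injective_private)

/-! ## The (C3) mass from a small lift -/

section Mass

variable (F : T3Family) (γ b₀ p₀ : ℝ) (j : ℕ)

/-- ★ **THE (C3) MASS FROM A SMALL LIFT + CHART REGULARITY IN THE ENVIRONMENT.**  With `β c := centralBond (bondShift h c)`: if (REG) the
target relation `{(U, v) | v ∈ T c U}` is open with `θ c` continuous and `jac c` positive on it (`jac c` measurable), (SOL) every `¾θ_{j+1}`-small
fine field `U` has `descend U c ∈ T c U` and `θ c U (descend U c) = U (β c)`, and (LIFT) every window datum has a `¾θ_{j+1}`-small lift, then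
for every `V ∈ window_j`: `0 < ∫⁻ U in {U | (∀ c, V c ∈ T c U) ∧ PlaqSmall (¾θ_{j+1}) (extend β (fun c => θ c U (V c)) U)}, ∏ c, jac c U (V c) ∂dU_{j+1}`
— the `hmass` binder of ✓`OrganTangentTriangularChart.regularPackage_of_oneVariableInverseLaws` [folklore]. [cite: Balaban1985Averaging, (10)-(13) p.19; Balaban1987RG1, (0.18) p.255] -/
theorem mass_of_smallLift
    (T : PBond (F.P j) 0 → GaugeField (F.P (j + 1)) 0 ↥(Matrix.specialUnitaryGroup (Fin 2) ℂ) → Set ↥(Matrix.specialUnitaryGroup (Fin 2) ℂ))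
    (θ : PBond (F.P j) 0 → GaugeField (F.P (j + 1)) 0 ↥(Matrix.specialUnitaryGroup (Fin 2) ℂ) →
      ↥(Matrix.specialUnitaryGroup (Fin 2) ℂ) → ↥(Matrix.specialUnitaryGroup (Fin 2) ℂ))
    (jac : PBond (F.P j) 0 → GaugeField (F.P (j + 1)) 0 ↥(Matrix.specialUnitaryGroup (Fin 2) ℂ) → ↥(Matrix.specialUnitaryGroup (Fin 2) ℂ) → ℝ≥0)
    (hTo : ∀ c, IsOpen {p : GaugeField (F.P (j + 1)) 0 ↥(Matrix.specialUnitaryGroup (Fin 2) ℂ) × ↥(Matrix.specialUnitaryGroup (Fin 2) ℂ) |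
      p.2 ∈ T c p.1})
    (hθc : ∀ c, ContinuousOn (fun p : GaugeField (F.P (j + 1)) 0 ↥(Matrix.specialUnitaryGroup (Fin 2) ℂ) × ↥(Matrix.specialUnitaryGroup (Fin 2) ℂ) =>
      θ c p.1 p.2) {p | p.2 ∈ T c p.1})
    (hjm : ∀ c, Measurable fun p : GaugeField (F.P (j + 1)) 0 ↥(Matrix.specialUnitaryGroup (Fin 2) ℂ) × ↥(Matrix.specialUnitaryGroup (Fin 2) ℂ) =>
      jac c p.1 p.2)
    (hjpos : ∀ c U v, v ∈ T c U → 0 < jac c U v)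
    (hsol : ∀ U : GaugeField (F.P (j + 1)) 0 ↥(Matrix.specialUnitaryGroup (Fin 2) ℂ), PlaqSmall (3 / 4 * θBal F.L γ b₀ p₀ (j + 1)) U →
      ∀ c, descend F ℰp j U c ∈ T c U ∧ θ c U (descend F ℰp j U c) = U (centralBond (bondShift (sitesPerDir_descend F j 0) c)))
    (hlift : ∀ V : GaugeField (F.P j) 0 ↥(Matrix.specialUnitaryGroup (Fin 2) ℂ), PlaqSmall (θBal F.L γ b₀ p₀ j) V →
      ∃ U₀ : GaugeField (F.P (j + 1)) 0 ↥(Matrix.specialUnitaryGroup (Fin 2) ℂ),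
        descend F ℰp j U₀ = V ∧ PlaqSmall (3 / 4 * θBal F.L γ b₀ p₀ (j + 1)) U₀) :
    ∀ V : GaugeField (F.P j) 0 ↥(Matrix.specialUnitaryGroup (Fin 2) ℂ), PlaqSmall (θBal F.L γ b₀ p₀ j) V →
      0 < ∫⁻ U in {U : GaugeField (F.P (j + 1)) 0 ↥(Matrix.specialUnitaryGroup (Fin 2) ℂ) | (∀ c, V c ∈ T c U) ∧
          PlaqSmall (3 / 4 * θBal F.L γ b₀ p₀ (j + 1))
            (extend (fun c : PBond (F.P j) 0 => centralBond (bondShift (sitesPerDir_descend F j 0) c)) (fun c => θ c U (V c)) U)},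
        ∏ c, (jac c U (V c) : ℝ≥0∞) ∂(fieldMeasure (F.P (j + 1)) 0 ↥(Matrix.specialUnitaryGroup (Fin 2) ℂ)) := by
  classical
  intro V hV
  set β : PBond (F.P j) 0 → PBond (F.P (j + 1)) 0 := fun c => centralBond (bondShift (sitesPerDir_descend F j 0) c) with hβ
  have hβi : Injective β := OrganTangentTriangularChart.injective_private F j
  set θ' : ℝ := θBal F.L γ b₀ p₀ (j + 1) with hθ'
  haveI : BorelSpace (GaugeField (F.P (j + 1)) 0 ↥(Matrix.specialUnitaryGroup (Fin 2) ℂ)) := T3OrbitAverage.instBorelSpaceGaugeField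
  haveI : (fieldMeasure (F.P (j + 1)) 0 ↥(Matrix.specialUnitaryGroup (Fin 2) ℂ)).IsOpenPosMeasure :=
    B12ContinuousTransportInvariance.isOpenPosMeasure_fieldMeasure_SU 2 (F.P (j + 1)) 0
  -- the good set of environments and the chart over it
  set G : Set (GaugeField (F.P (j + 1)) 0 ↥(Matrix.specialUnitaryGroup (Fin 2) ℂ)) := {U | ∀ c, V c ∈ T c U} with hG
  set Ψ : GaugeField (F.P (j + 1)) 0 ↥(Matrix.specialUnitaryGroup (Fin 2) ℂ) → GaugeField (F.P (j + 1)) 0 ↥(Matrix.specialUnitaryGroup (Fin 2) ℂ) :=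
    fun U => extend β (fun c => θ c U (V c)) U with hΨ
  set O : Set (GaugeField (F.P (j + 1)) 0 ↥(Matrix.specialUnitaryGroup (Fin 2) ℂ)) := {U | PlaqSmall (3 / 4 * θ') U} with hO
  have hOopen : IsOpen O := by
    have e : O = ⋂ p : Plaq (F.P (j + 1)) 0, {U | dist1 (GaugeField.plaqHol U p) < 3 / 4 * θ'} := by
      ext U; simp only [hO, PlaqSmall, Set.mem_setOf_eq, Set.mem_iInter]
    rw [e]
    exact isOpen_iInter_of_finite fun p => isOpen_lt (continuous_dist1_plaqHol p) continuous_const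
  have hGopen : IsOpen G := by
    have e : G = ⋂ c, (fun U : GaugeField (F.P (j + 1)) 0 ↥(Matrix.specialUnitaryGroup (Fin 2) ℂ) => (U, V c)) ⁻¹'
        {p : GaugeField (F.P (j + 1)) 0 ↥(Matrix.specialUnitaryGroup (Fin 2) ℂ) × ↥(Matrix.specialUnitaryGroup (Fin 2) ℂ) | p.2 ∈ T c p.1} := by
      ext U; simp only [hG, Set.mem_setOf_eq, Set.mem_iInter, Set.mem_preimage]
    rw [e]
    exact isOpen_iInter_of_finite fun c => (hTo c).preimage (Continuous.prodMk_left (V c))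
  -- the chart is continuous on the good set (coordinate by coordinate)
  have hΨc : ContinuousOn Ψ G := by
    refine continuousOn_pi.2 fun b => ?_
    by_cases hb : ∃ c, β c = b
    · obtain ⟨c, rfl⟩ := hb
      have e : ∀ U, Ψ U (β c) = θ c U (V c) := fun U => hβi.extend_apply _ _ c
      simp_rw [e]
      exact (hθc c).comp (Continuous.prodMk_left (V c)).continuousOn fun U hU => hU c
    · have e : ∀ U, Ψ U b = U b := fun U => extend_apply' _ _ _ hb
      simp_rw [e]
      exact (continuous_apply b).continuousOn
  -- the integration set `= G ∩ Ψ ⁻¹' O` (definitionally) is open …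
  have hAopen : IsOpen (G ∩ Ψ ⁻¹' O) := hΨc.isOpen_inter_preimage hGopen hOopen
  -- … and contains the lift
  obtain ⟨U₀, hU₀V, hU₀s⟩ := hlift V hV
  have hU₀G : U₀ ∈ G := fun c => by
    rw [show V c = descend F ℰp j U₀ c by rw [hU₀V]]
    exact (hsol U₀ hU₀s c).1
  have hΨU₀ : Ψ U₀ = U₀ := by
    funext b
    by_cases hb : ∃ c, β c = b
    · obtain ⟨c, rfl⟩ := hb
      rw [show Ψ U₀ (β c) = θ c U₀ (V c) from hβi.extend_apply _ _ c,
        show V c = descend F ℰp j U₀ c by rw [hU₀V]]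
      exact (hsol U₀ hU₀s c).2
    · exact extend_apply' _ _ _ hb
  have hU₀A : U₀ ∈ G ∩ Ψ ⁻¹' O := ⟨hU₀G, by rw [Set.mem_preimage, hΨU₀]; exact hU₀s⟩
  have hApos : 0 < fieldMeasure (F.P (j + 1)) 0 ↥(Matrix.specialUnitaryGroup (Fin 2) ℂ) (G ∩ Ψ ⁻¹' O) :=
    hAopen.measure_pos _ ⟨U₀, hU₀A⟩
  -- the integrand is measurable and positive on the set
  have hfm : Measurable fun U : GaugeField (F.P (j + 1)) 0 ↥(Matrix.specialUnitaryGroup (Fin 2) ℂ) => ∏ c, (jac c U (V c) : ℝ≥0∞) := by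
    refine Finset.measurable_prod _ fun c _ => ?_
    exact measurable_coe_nnreal_ennreal.comp ((hjm c).comp (measurable_prodMk_right : Measurable fun U :
      GaugeField (F.P (j + 1)) 0 ↥(Matrix.specialUnitaryGroup (Fin 2) ℂ) => (U, V c)))
  have hfne : ∀ U ∈ G ∩ Ψ ⁻¹' O, (∏ c, (jac c U (V c) : ℝ≥0∞)) ≠ 0 := by
    intro U hU
    exact Finset.prod_ne_zero_iff.2 fun c _ => ENNReal.coe_ne_zero.2 (hjpos c U (V c) (hU.1 c)).ne'
  show 0 < ∫⁻ U in G ∩ Ψ ⁻¹' O, ∏ c, (jac c U (V c) : ℝ≥0∞) ∂(fieldMeasure (F.P (j + 1)) 0 ↥(Matrix.specialUnitaryGroup (Fin 2) ℂ))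
  rw [lintegral_pos_iff_support hfm, Measure.restrict_apply' hAopen.measurableSet]
  refine hApos.trans_le (measure_mono fun U hU => ⟨Function.mem_support.2 (hfne U hU), hU⟩)

end Mass

end Summit.QuantumFields.YangMills.Theorems.OrganTangentMassOfSmallLift

end
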